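import Summits.Ventures.GridStability.Lyapunov.WSCC9LossySlabData

/-!
# GridStability/Lyapunov/WSCC9LossySlabPsd — scalar side conditions, `P − ε·1 ⪰ 0` and the six rank-one
# facts `s_k·P − C_kᵀC_k ⪰ 0` of the #35 lane-V certificate (kernel, integer Gram certificates)

Data in `WSCC9LossySlabData` (sos-2 Λ `2541e15e`, pack `0d3f30ad`). CERTIFIED (kernel) facts about the
literal data; nothing here says a grid is stable.
-/

namespace Summit.Ventures.GridStability.Lyapunov.WSCC9LossySlab

open Literature.Computation.Certificates

/-- `ε > 0`. -/
theorem epsQ_pos : 0 < epsQ := by norm_num [epsQ]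

/-- `η > 0`. -/
theorem etaQ_pos : 0 < etaQ := by norm_num [etaQ]

/-- `τ_k ≥ 0`. -/
theorem tauQ_nonneg : ∀ k, 0 ≤ tauQ k := by decide +kernel

/-- `λ_k ≥ 0`. -/
theorem lamQ_nonneg : ∀ k, 0 ≤ lamQ k := by decide +kernel

/-- Popov only on channels with `a_k ≥ 0`. -/
theorem aQ_nonneg_of_lamQ_pos : ∀ k, 0 < lamQ k → 0 ≤ aQ k := by decide +kernel

/-- `a_k ≥ 0` off the diagonal (the six active channels). -/
theorem aQ_nonneg_of_ne : ∀ k : Fin 3 × Fin 3, k.1 ≠ k.2 → 0 ≤ aQ (finProdFinEquiv k) := by decide +kernel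

/-- Diagonal channels carry the trivial sector `[−1, 1]`. -/
theorem aQ_bQ_diag : ∀ p : Fin 3, aQ (finProdFinEquiv (p, p)) = -1 ∧ bQ (finProdFinEquiv (p, p)) = 1 := by
  decide +kernel

/-- `0 ≤ b_k`. -/
theorem bQ_nonneg : ∀ k, 0 ≤ bQ k := by decide +kernel

/-- `s_k > 0`. -/
theorem sQ_pos : ∀ k, 0 < sQ k := by decide +kernel

/-- The `γ_lo` test: `0 ≤ γ_lo`, `γ_lo²(1 + u²) ≤ 4u²` (so `γ_lo < 2·arctan u`). -/
theorem gammaLo_test : 0 ≤ gammaLoQ ∧ gammaLoQ ^ 2 * (1 + uQ ^ 2) ≤ 4 * uQ ^ 2 := by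
  norm_num [gammaLoQ, uQ]

/-- The rank-one level test: `c·s_k < γ_lo²` on every channel. -/
theorem level_test : ∀ k, cQ * sQ k < gammaLoQ ^ 2 := by decide +kernel

/-- `c > 0`. -/
theorem cQ_pos : 0 < cQ := by norm_num [cQ]

/-- `0 < u ≤ 1`. -/
theorem uQ_pos_le : 0 < uQ ∧ uQ ≤ 1 := by norm_num [uQ]

/-- `cos γ`, `sin γ` literals agree with `u`. -/
theorem cgQ_sgQ : cgQ = (1 - uQ ^ 2) / (1 + uQ ^ 2) ∧ sgQ = 2 * uQ / (1 + uQ ^ 2) := ⟨rfl, rfl⟩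

/-- `P` is symmetric (entrywise, kernel). -/
theorem Pq_symm : ∀ i j, Pq i j = Pq j i := by decide +kernel

/-- `lo_j ≤ hi_j`. -/
theorem loQ_le_hiQ : ∀ j, loQ j ≤ hiQ j := by decide +kernel

/-- Integer Gram certificate check for `P − ε·1`. -/
theorem pe_cert : PSD.IsGramCertZ (matrixOfRows 5 5 peA) (vecOfList 5 d5) (matrixOfCols 5 5 peBT) :=
  PSD.IsGramCertZ.of_listCheck' (by decide +kernel) (by decide +kernel)

/-- **`P − ε·1 ⪰ 0`** over `ℝ`. -/
theorem posSemidef_Pe :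
    ((Pq - epsQ • (1 : Matrix (Fin 5) (Fin 5) ℚ)).map (Rat.cast : ℚ → ℝ)).PosSemidef :=
  pe_cert.posSemidef_of_smul (c := (274877906944 : ℚ)) (by norm_num) (by decide +kernel)

/-- Integer Gram certificate check for `R_1 = s_1·P − C_1ᵀC_1`. -/
theorem r1_cert : PSD.IsGramCertZ (matrixOfRows 5 5 r1A) (vecOfList 5 d5) (matrixOfCols 5 5 r1BT) :=
  PSD.IsGramCertZ.of_listCheck' (by decide +kernel) (by decide +kernel)

/-- **`s_1·P − C_1ᵀC_1 ⪰ 0`** over `ℝ`. -/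
theorem posSemidef_R1 : ((Rk 1).map (Rat.cast : ℚ → ℝ)).PosSemidef :=
  r1_cert.posSemidef_of_smul (c := (1180591620717411303424 : ℚ)) (by norm_num) (by decide +kernel)

/-- Integer Gram certificate check for `R_2 = s_2·P − C_2ᵀC_2`. -/
theorem r2_cert : PSD.IsGramCertZ (matrixOfRows 5 5 r2A) (vecOfList 5 d5) (matrixOfCols 5 5 r2BT) :=
  PSD.IsGramCertZ.of_listCheck' (by decide +kernel) (by decide +kernel)

/-- **`s_2·P − C_2ᵀC_2 ⪰ 0`** over `ℝ`. -/
theorem posSemidef_R2 : ((Rk 2).map (Rat.cast : ℚ → ℝ)).PosSemidef :=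
  r2_cert.posSemidef_of_smul (c := (295147905179352825856 : ℚ)) (by norm_num) (by decide +kernel)

/-- Integer Gram certificate check for `R_3 = s_3·P − C_3ᵀC_3`. -/
theorem r3_cert : PSD.IsGramCertZ (matrixOfRows 5 5 r3A) (vecOfList 5 d5) (matrixOfCols 5 5 r3BT) :=
  PSD.IsGramCertZ.of_listCheck' (by decide +kernel) (by decide +kernel)

/-- **`s_3·P − C_3ᵀC_3 ⪰ 0`** over `ℝ`. -/
theorem posSemidef_R3 : ((Rk 3).map (Rat.cast : ℚ → ℝ)).PosSemidef :=
  r3_cert.posSemidef_of_smul (c := (1180591620717411303424 : ℚ)) (by norm_num) (by decide +kernel)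

/-- Integer Gram certificate check for `R_5 = s_5·P − C_5ᵀC_5`. -/
theorem r5_cert : PSD.IsGramCertZ (matrixOfRows 5 5 r5A) (vecOfList 5 d5) (matrixOfCols 5 5 r5BT) :=
  PSD.IsGramCertZ.of_listCheck' (by decide +kernel) (by decide +kernel)

/-- **`s_5·P − C_5ᵀC_5 ⪰ 0`** over `ℝ`. -/
theorem posSemidef_R5 : ((Rk 5).map (Rat.cast : ℚ → ℝ)).PosSemidef :=
  r5_cert.posSemidef_of_smul (c := (4611686018427387904 : ℚ)) (by norm_num) (by decide +kernel)

/-- Integer Gram certificate check for `R_6 = s_6·P − C_6ᵀC_6`. -/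
theorem r6_cert : PSD.IsGramCertZ (matrixOfRows 5 5 r6A) (vecOfList 5 d5) (matrixOfCols 5 5 r6BT) :=
  PSD.IsGramCertZ.of_listCheck' (by decide +kernel) (by decide +kernel)

/-- **`s_6·P − C_6ᵀC_6 ⪰ 0`** over `ℝ`. -/
theorem posSemidef_R6 : ((Rk 6).map (Rat.cast : ℚ → ℝ)).PosSemidef :=
  r6_cert.posSemidef_of_smul (c := (295147905179352825856 : ℚ)) (by norm_num) (by decide +kernel)

/-- Integer Gram certificate check for `R_7 = s_7·P − C_7ᵀC_7`. -/
theorem r7_cert : PSD.IsGramCertZ (matrixOfRows 5 5 r7A) (vecOfList 5 d5) (matrixOfCols 5 5 r7BT) :=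
  PSD.IsGramCertZ.of_listCheck' (by decide +kernel) (by decide +kernel)

/-- **`s_7·P − C_7ᵀC_7 ⪰ 0`** over `ℝ`. -/
theorem posSemidef_R7 : ((Rk 7).map (Rat.cast : ℚ → ℝ)).PosSemidef :=
  r7_cert.posSemidef_of_smul (c := (4611686018427387904 : ℚ)) (by norm_num) (by decide +kernel)

/-- The six rank-one facts packaged by channel index `k = 3p + q` (diagonal channels excluded). -/
theorem posSemidef_Rk (k : Fin 9) (hk : k ≠ 0 ∧ k ≠ 4 ∧ k ≠ 8) :
    ((Rk k).map (Rat.cast : ℚ → ℝ)).PosSemidef := by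
  fin_cases k
  · exact absurd rfl hk.1
  · exact posSemidef_R1
  · exact posSemidef_R2
  · exact posSemidef_R3
  · exact absurd rfl hk.2.1
  · exact posSemidef_R5
  · exact posSemidef_R6
  · exact posSemidef_R7
  · exact absurd rfl hk.2.2

end Summit.Ventures.GridStability.Lyapunov.WSCC9LossySlab
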